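import Literature.NumberTheory.EllipticCurves.MatsunoCurvesRankDescent
import Mathlib.NumberTheory.LegendreSymbol.QuadraticReciprocity
import Mathlib.RingTheory.Ideal.Norm.AbsNorm
import Mathlib.FieldTheory.Finite.Basic
import HarnessLib

/-!
# Matsuno 2009, Proposition 5.4 on `λ_K(A(K))`: `L ∩ λ_K(A(K)) = {1}` (proof)

`Proofs` companion of `Literature/NumberTheory/EllipticCurves/MatsunoCurvesRankDescent.lean`
(K. Matsuno, *Elliptic curves with large Tate–Shafarevich groups over a number field*, Math. Res.
Lett. **16** (2009), 449–461): it PROVES the second hypothesis `h54` of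
`MatsunoParams.mordellWeilRank_le_of_lemma53_of_prop54`, i.e. **Proposition 5.4** (p. 457)
together with "`dim_{𝔽₂} L = 4k`", restricted to the image of `A(K)`: an element `spanMap c` of
the span `L` which is the `2`-descent image of a point of `A(K)` has `c = 0`
(`MatsunoParams.eq_zero_of_spanMap_mem_descentRange`), for Matsuno's parameters over a number
field `K` of odd degree `n = [K : ℚ]`.

Printed proof (p. 457): "Take an element `(x, y, z) ∈ L ∩ λ_K(Sel₂(A/K))` and suppose `y` is
represented by `q := ℓ₁^{e₁}⋯ℓ_k^{e_k} m₁^{f₁}⋯m_k^{f_k}` (`eᵢ, fⱼ ∈ {0, 1}`). It is known that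
`y` is contained in the kernel of the natural map `K^×/K^{×2} → K_{ℓᵢ}^×/K_{ℓᵢ}^{×2}` for any `i`
(cf. [3, Section 4], [18, Section 2]). This implies that `ord_{ℓᵢ}(y) = 0`, i.e., `eᵢ = 0`.
Moreover, we have `fᵢ = 0` since `mᵢ ∉ K_{ℓᵢ}^{×2}` and `mⱼ ∈ K_{ℓᵢ}^{×2}` for any `j ≠ i` by
(A4). (Recall that `n = [K : ℚ]` is odd.) Thus, `y` is trivial in `K^×/K^{×2}`. Similar argument
shows that `z` is trivial since the image of `z` in `K_{mⱼ}^×/K_{mⱼ}^{×2}` should be trivial for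
any `j` and `(ℓᵢ/mⱼ) = (−1)^{δᵢⱼ}` by (A1) and (A4)."

The "known" local statement ([3] = Brumer–Kramer, §4; [18] = Kramer 1983, §2 / Lemma 2) is that
at a prime `v` of (split) multiplicative reduction where two of the `2`-torsion abscissae
coincide mod `v`, the descent coordinate at the ISOLATED abscissa is locally a square. We prove
it here by the direct valuation argument (no completions, no Hensel: "locally a square" is
replaced by the explicit first-order condition `c = u·r²`, `v(u − 1) < 1`, which is all the
argument uses):

* §1 `Valuation.IsLocSq v c` — `c = u r²` with `v(u − 1) < 1`, `r ≠ 0`: a subgroup of `K^×`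
  containing the squares; its valuations are even (`IsLocSq.two_dvd_log`).
* §2 **The local lemma** `Valuation.isLocSq_sub_of_sq_eq`: for `y² = (x − e₁)(x − e₂)(x − e₃)`
  with `v(eᵢ) ≤ 1`, `v(e₂ − e₃) < 1` (the abscissae `e₂, e₃` coincide mod `v`), `v(e₁ − e₂) = 1`
  and `e₂ − e₁` locally a square (the node is split), `x − e₁` is locally a square (`x ≠ e₁`),
  and so is the torsion value `(e₁ − e₂)(e₁ − e₃)`. (Cases `v(x) > 1`; `x ≡ e₂`; `x ≢ e₂`.)
* §3 **Inert primes of odd residue degree**: for `v = (p)` with `p` a rational prime remaining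
  prime in `K` and `[K : ℚ]` odd, an integer `N` prime to `p` which is locally a square at `v` is
  a quadratic residue mod `p` (`NumberField.legendreSym_eq_one_of_isLocSq`): `N β² ≡ α² (mod v)`
  in `𝓞_K` (denominators prime to `p` can be arranged since `(p)` is principal,
  `exists_mul_eq_of_valuation_le_one`), so `N^{(p^n−1)/2} ≡ 1` in `𝓞_K/(p) = 𝔽_{p^n}`, hence
  `mod p` (`(p) ∩ ℤ = pℤ`, by norms), and `(p^n − 1)/2 = ((p−1)/2)·(1 + p + ⋯ + p^{n−1})` with the
  second factor odd, so Euler's criterion gives `(N/p) = 1`. This is the printed "Recall that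
  `n = [K : ℚ]` is odd".
* §4 **Proposition 5.4**: at `v = (ℓᵢ)` the coordinate `y = x + 4m = x − e₁` is locally a square
  (`e₂ = −l/4 ≡ 0 = e₃`, `e₂ − e₁ = −1/4` is locally a square as `ℓᵢ ≡ 1 (mod 4)`, (A1)); at
  `v = (mⱼ)` the coordinate `z = x + l/4 = x − e₂` is (`e₁ = −4m ≡ 0 = e₃`, `e₁ − e₂ = 1/4`).
  If `λ_K(P) = spanMap ((a,b),(a',b'))`, i.e. `y ≡ ∏ ℓᵢ^{aᵢ} mⱼ^{bⱼ}`, `z ≡ ∏ ℓᵢ^{a'ᵢ} mⱼ^{b'ⱼ}`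
  modulo squares, then parity of `ord_{ℓᵢ}` gives `aᵢ = 0`, quadratic residues at `ℓᵢ` with (A4)
  give `bᵢ = 0`, parity at `mⱼ` gives `b'ⱼ = 0`, and residues at `mⱼ` with quadratic reciprocity
  (`ℓᵢ ≡ 1 (mod 4)`) and (A4) give `a'ⱼ = 0`.

## References

* [Matsuno2009] K. Matsuno, Math. Res. Lett. 16 (2009), 449–461, Prop. 5.4 and its proof,
  "`dim_{𝔽₂} L = 4k`" (p. 457); (A1)–(A4) (p. 456).
* [Kramer1983] K. Kramer, Proc. Amer. Math. Soc. 89 (1983), 379–386, §2, Lemma 2 (the local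
  images at multiplicative primes).
* [BrumerKramer1977] A. Brumer, K. Kramer, Duke Math. J. 44 (1977), 715–743, §4.

## Design

Theorems only (one `Prop`-valued structure with parameters, `Valuation.IsLocSq`, the predicate
"locally a square"; no named facts, no definitions of constants). Height-one primes `(p)` are
passed as `v` with `hv : v.asIdeal = Ideal.span {p}`. `open scoped Classical`, no
`[DecidableEq K]`, as in `MatsunoCurvesRankDescent.lean`.
-/

noncomputable section

open scoped Classical NumberField WithZero

open IsDedekindDomain NumberField WeierstrassCurve WeierstrassCurve.Affine Finset

/-! ## §1 Locally-square elements for a valuation -/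

namespace Valuation

variable {L : Type*} [Field L] (v : Valuation L ℤᵐ⁰)

/-- **`c` is locally a square at `v`**: `c = u · r²` with `u ≡ 1 (mod v)` (`v(u − 1) < 1`) and
`r ≠ 0` — the first-order form of "`c ∈ L_v^{×2}`" (for odd residue characteristic these are,
by Hensel's lemma, exactly the non-zero elements that are squares in the completion; only this
explicit form is used). This is how "`y` is contained in the kernel of
`K^×/K^{×2} → K_{ℓᵢ}^×/K_{ℓᵢ}^{×2}`" (Matsuno p. 457; Kramer 1983, Lemma 2) is transcribed.
[cite: Matsuno2009, proof of Proposition 5.4] -/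
structure IsLocSq (c : L) : Prop where
  out : ∃ u r : L, v (u - 1) < 1 ∧ r ≠ 0 ∧ c = u * r ^ 2

variable {v}

/-- `v(u − 1) < 1` forces `v(u) = 1`. [folklore] -/
theorem map_eq_one_of_map_sub_one_lt {u : L} (hu : v (u - 1) < 1) : v u = 1 := by
  have h := v.map_one_add_of_lt hu
  rwa [add_sub_cancel] at h

namespace IsLocSq

/-- An element `≡ 1 (mod v)` is locally a square. [folklore] -/
theorem of_lt {u : L} (hu : v (u - 1) < 1) : v.IsLocSq u :=
  ⟨⟨u, 1, hu, one_ne_zero, by ring⟩⟩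

/-- `1` is locally a square. [folklore] -/
theorem one : v.IsLocSq 1 :=
  of_lt (by rw [sub_self, Valuation.map_zero]; exact zero_lt_one)

/-- A non-zero square is locally a square. [folklore] -/
theorem sq {r : L} (hr : r ≠ 0) : v.IsLocSq (r ^ 2) :=
  ⟨⟨1, r, by rw [sub_self, Valuation.map_zero]; exact zero_lt_one, hr, by ring⟩⟩

/-- Locally-square elements are non-zero. [folklore] -/
theorem ne_zero {c : L} (h : v.IsLocSq c) : c ≠ 0 := by
  obtain ⟨u, r, hu, hr, rfl⟩ := h.out
  refine mul_ne_zero (fun h0 => ?_) (pow_ne_zero 2 hr)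
  have h1 := map_eq_one_of_map_sub_one_lt hu
  rw [h0, Valuation.map_zero] at h1
  exact zero_ne_one h1

/-- Locally-square elements form a multiplicative set. [folklore] -/
theorem mul {c₁ c₂ : L} (h₁ : v.IsLocSq c₁) (h₂ : v.IsLocSq c₂) : v.IsLocSq (c₁ * c₂) := by
  obtain ⟨u₁, r₁, hu₁, hr₁, rfl⟩ := h₁.out
  obtain ⟨u₂, r₂, hu₂, hr₂, rfl⟩ := h₂.out
  refine ⟨⟨u₁ * u₂, r₁ * r₂, ?_, mul_ne_zero hr₁ hr₂, by ring⟩⟩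
  have hv₁ : v u₁ = 1 := map_eq_one_of_map_sub_one_lt hu₁
  calc v (u₁ * u₂ - 1) = v (u₁ * (u₂ - 1) + (u₁ - 1)) := by congr 1; ring
    _ ≤ max (v (u₁ * (u₂ - 1))) (v (u₁ - 1)) := v.map_add _ _
    _ < 1 := max_lt (by rw [Valuation.map_mul, hv₁, one_mul]; exact hu₂) hu₁

/-- … closed under inverses. [folklore] -/
theorem inv {c : L} (h : v.IsLocSq c) : v.IsLocSq c⁻¹ := by
  obtain ⟨u, r, hu, hr, rfl⟩ := h.out
  have hv : v u = 1 := map_eq_one_of_map_sub_one_lt hu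
  have hu0 : u ≠ 0 := fun h0 => by rw [h0, Valuation.map_zero] at hv; exact zero_ne_one hv
  refine ⟨⟨u⁻¹, r⁻¹, ?_, inv_ne_zero hr, by rw [mul_inv, inv_pow]⟩⟩
  have h1 : u⁻¹ - 1 = u⁻¹ * (1 - u) := by rw [mul_sub, mul_one, inv_mul_cancel₀ hu0]
  rw [h1, Valuation.map_mul, map_inv₀, hv, inv_one, one_mul, Valuation.map_sub_swap]
  exact hu

/-- If `a` is locally a square and `ab` is a non-zero square then `b` is locally a square.
[folklore] -/
theorem of_mul_eq_sq {a b z : L} (ha : v.IsLocSq a) (hz : z ≠ 0) (h : a * b = z ^ 2) :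
    v.IsLocSq b := by
  have ha0 : a ≠ 0 := ha.ne_zero
  have hb : b = z ^ 2 * a⁻¹ := by
    rw [eq_mul_inv_iff_mul_eq₀ ha0, mul_comm]
    exact h
  rw [hb]
  exact (sq hz).mul ha.inv

/-- **Locally-square elements have even valuation.** [folklore] -/
theorem two_dvd_log {c : L} (h : v.IsLocSq c) : (2 : ℤ) ∣ WithZero.log (v c) := by
  obtain ⟨u, r, hu, hr, rfl⟩ := h.out
  rw [Valuation.map_mul, map_eq_one_of_map_sub_one_lt hu, one_mul, Valuation.map_pow,
    WithZero.log_pow, nsmul_eq_mul]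
  exact ⟨WithZero.log (v r), by push_cast; ring⟩

end IsLocSq

/-! ## §2 The local lemma at a prime where two `2`-torsion abscissae coincide -/

/-- **The torsion value at the isolated abscissa is locally a square**: if `v(e₁ − e₂) = 1` and
`v(e₂ − e₃) < 1` then `(e₁ − e₂)(e₁ − e₃) = (e₁ − e₂)² (1 + (e₂ − e₃)/(e₁ − e₂))` is locally a
square. (Kramer 1983, Lemma 2: the value of the descent map at the `2`-torsion point.)
[cite: Kramer1983, Lemma 2] -/
theorem isLocSq_mul_sub_sub {e₁ e₂ e₃ : L} (h₁₂ : v (e₁ - e₂) = 1) (h₂₃ : v (e₂ - e₃) < 1) :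
    v.IsLocSq ((e₁ - e₂) * (e₁ - e₃)) := by
  have hne : e₁ - e₂ ≠ 0 := v.ne_zero_iff.mp (h₁₂ ▸ one_ne_zero)
  have hfac : (e₁ - e₂) * (e₁ - e₃) = (e₁ - e₂) ^ 2 * (1 + (e₂ - e₃) / (e₁ - e₂)) := by
    field_simp
    ring
  rw [hfac]
  refine (IsLocSq.sq hne).mul (IsLocSq.of_lt ?_)
  rw [add_sub_cancel_left, map_div₀, h₁₂, div_one]
  exact h₂₃

/-- **The local lemma** (the "known" input of Matsuno's Prop. 5.4: Brumer–Kramer §4, Kramer 1983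
§2 / Lemma 2 — at a prime of multiplicative reduction where the abscissae `e₂ ≡ e₃ (mod v)`
coincide and the node is split, the descent coordinate `x − e₁` at the isolated abscissa is
locally a square). Hypotheses: `v(eᵢ) ≤ 1`, `v(e₂ − e₃) < 1`, `v(e₁ − e₂) = 1`, `e₂ − e₁`
locally a square; `y² = (x − e₁)(x − e₂)(x − e₃)`, `x ≠ e₁`. Proof by valuations: if `v(x) > 1`
then each `x − eᵢ = x(1 − eᵢ/x)` with `1 − eᵢ/x ≡ 1`, so `x³`, hence `x`, hence `x − e₁` is
locally a square; if `x ≡ e₂ (mod v)` then `x − e₁ = (e₂ − e₁)(1 + (x − e₂)/(e₂ − e₁))`; otherwise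
`x − e₂, x − e₃` are units with `(x − e₂)(x − e₃) = (x − e₂)²(1 + (e₂ − e₃)/(x − e₂))` locally a
square, and `x − e₁ = y²/((x − e₂)(x − e₃))`. [cite: Kramer1983, Lemma 2] -/
theorem isLocSq_sub_of_sq_eq {e₁ e₂ e₃ x y : L} (he₁ : v e₁ ≤ 1) (he₂ : v e₂ ≤ 1) (he₃ : v e₃ ≤ 1)
    (h₂₃ : v (e₂ - e₃) < 1) (h₁₂ : v (e₁ - e₂) = 1) (hsq : v.IsLocSq (e₂ - e₁)) (hx : x ≠ e₁)
    (hy : y ^ 2 = (x - e₁) * (x - e₂) * (x - e₃)) : v.IsLocSq (x - e₁) := by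
  rcases lt_or_ge 1 (v x) with hxv | hxv
  · -- `v x > 1`
    have hvx0 : (0 : ℤᵐ⁰) < v x := lt_trans zero_lt_one hxv
    have hx0 : x ≠ 0 := v.ne_zero_iff.mp hvx0.ne'
    have hu : ∀ e, v e ≤ 1 → v (1 - e / x - 1) < 1 := fun e he => by
      rw [sub_sub_cancel_left, Valuation.map_neg, map_div₀, div_lt_one₀ hvx0]
      exact lt_of_le_of_lt he hxv
    have hfac : ∀ e, x - e = x * (1 - e / x) := fun e => by field_simp
    have hne : ∀ e, v e ≤ 1 → x - e ≠ 0 := fun e he => by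
      rw [hfac e]
      exact mul_ne_zero hx0 (IsLocSq.of_lt (hu e he)).ne_zero
    have hY : y ≠ 0 := fun h0 => by
      rw [h0, zero_pow two_ne_zero, eq_comm, mul_eq_zero, mul_eq_zero] at hy
      rcases hy with (h | h) | h
      · exact hne e₁ he₁ h
      · exact hne e₂ he₂ h
      · exact hne e₃ he₃ h
    have hprod : ((1 - e₁ / x) * (1 - e₂ / x) * (1 - e₃ / x)) * x ^ 3 = y ^ 2 := by
      rw [hy, hfac e₁, hfac e₂, hfac e₃]; ring
    have hloc3 : v.IsLocSq (x ^ 3) :=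
      IsLocSq.of_mul_eq_sq (((IsLocSq.of_lt (hu e₁ he₁)).mul (IsLocSq.of_lt (hu e₂ he₂))).mul
        (IsLocSq.of_lt (hu e₃ he₃))) hY hprod
    have hlocx : v.IsLocSq x := by
      have h := hloc3.mul (IsLocSq.sq (inv_ne_zero hx0))
      have hxe : x ^ 3 * x⁻¹ ^ 2 = x := by field_simp
      rwa [hxe] at h
    rw [hfac e₁]
    exact hlocx.mul (IsLocSq.of_lt (hu e₁ he₁))
  · -- `v x ≤ 1`
    have hxe₂ : v (x - e₂) ≤ 1 := v.map_sub_le hxv he₂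
    rcases hxe₂.lt_or_eq with hlt | heq
    · -- `x ≡ e₂ (mod v)`
      have h₂₁ : v (e₂ - e₁) = 1 := by rw [Valuation.map_sub_swap, h₁₂]
      have hne : e₂ - e₁ ≠ 0 := v.ne_zero_iff.mp (h₂₁ ▸ one_ne_zero)
      have hfac : x - e₁ = (e₂ - e₁) * (1 + (x - e₂) / (e₂ - e₁)) := by
        field_simp
        ring
      rw [hfac]
      refine hsq.mul (IsLocSq.of_lt ?_)
      rw [add_sub_cancel_left, map_div₀, h₂₁, div_one]
      exact hlt
    · -- `x − e₂`, `x − e₃` units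
      have hxe₃ : v (x - e₃) = 1 := by
        rw [show x - e₃ = (x - e₂) + (e₂ - e₃) by ring, v.map_add_eq_of_lt_left (by rwa [heq])]
        exact heq
      have hne₂ : x - e₂ ≠ 0 := v.ne_zero_iff.mp (heq ▸ one_ne_zero)
      have hne₃ : x - e₃ ≠ 0 := v.ne_zero_iff.mp (hxe₃ ▸ one_ne_zero)
      have hY : y ≠ 0 := fun h0 => by
        rw [h0, zero_pow two_ne_zero, eq_comm, mul_eq_zero, mul_eq_zero] at hy
        rcases hy with (h | h) | h
        · exact hx (sub_eq_zero.mp h)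
        · exact hne₂ h
        · exact hne₃ h
      have hfac : (x - e₂) * (x - e₃) = (x - e₂) ^ 2 * (1 + (e₂ - e₃) / (x - e₂)) := by
        field_simp
        ring
      have hloc : v.IsLocSq ((x - e₂) * (x - e₃)) := by
        rw [hfac]
        refine (IsLocSq.sq hne₂).mul (IsLocSq.of_lt ?_)
        rw [add_sub_cancel_left, map_div₀, heq, div_one]
        exact h₂₃
      exact hloc.of_mul_eq_sq hY (by rw [hy]; ring)

end Valuation

/-! ## §3 Inert primes of a number field of odd degree -/

namespace NumberField

variable {K : Type*} [Field K] [NumberField K]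

/-- **`(p) ∩ ℤ = pℤ` in `𝓞_K`**: an integer lying in the principal ideal `(p)` of `𝓞_K`
(`p` a natural number) is divisible by `p` — taking norms, `z^N = N(a) p^N`. [folklore] -/
theorem dvd_of_intCast_mem_span {p : ℕ} {z : ℤ}
    (hz : (z : 𝓞 K) ∈ Ideal.span ({(p : 𝓞 K)} : Set (𝓞 K))) : (p : ℤ) ∣ z := by
  obtain ⟨a, ha⟩ := Ideal.mem_span_singleton'.mp hz
  set ι := Module.Free.ChooseBasisIndex ℤ (𝓞 K)
  haveI : Nonempty ι := (RingOfIntegers.basis K).index_nonempty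
  have hn : Fintype.card ι ≠ 0 := Fintype.card_ne_zero
  have h1 : Algebra.norm ℤ (z : 𝓞 K) = z ^ Fintype.card ι := by
    rw [← map_intCast (algebraMap ℤ (𝓞 K)) z]
    exact Algebra.norm_algebraMap_of_basis (RingOfIntegers.basis K) z
  have h2 : Algebra.norm ℤ (p : 𝓞 K) = (p : ℤ) ^ Fintype.card ι := by
    rw [← map_natCast (algebraMap ℤ (𝓞 K)) p]
    exact Algebra.norm_algebraMap_of_basis (RingOfIntegers.basis K) (p : ℤ)
  have h3 : z ^ Fintype.card ι = Algebra.norm ℤ a * (p : ℤ) ^ Fintype.card ι := by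
    rw [← h1, ← ha, map_mul, h2]
  exact (Int.pow_dvd_pow_iff hn).mp (Dvd.intro_left _ h3.symm)

/-- An integer prime to `p` is a `v`-unit at `v = (p)`. [folklore] -/
theorem valuation_intCast_eq_one {p : ℕ} (v : HeightOneSpectrum (𝓞 K))
    (hv : v.asIdeal = Ideal.span ({(p : 𝓞 K)} : Set (𝓞 K))) {z : ℤ} (hz : ¬ (p : ℤ) ∣ z) :
    v.valuation K (z : K) = 1 := by
  have h1 : v.intValuation (z : 𝓞 K) = 1 := by
    refine le_antisymm (v.intValuation_le_one _) ?_
    rw [← not_lt, v.intValuation_lt_one_iff_mem, hv]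
    exact fun h => hz (dvd_of_intCast_mem_span h)
  have h2 : v.valuation K (algebraMap (𝓞 K) K (z : 𝓞 K)) = 1 := by
    rw [HeightOneSpectrum.valuation_of_algebraMap, h1]
  exact h2

/-- `v(p) = exp(−1)` at the prime `v = (p)` (`p` is a uniformiser: `p` remains prime).
[folklore] -/
theorem valuation_natCast_self {p : ℕ} (hp : p.Prime) (v : HeightOneSpectrum (𝓞 K))
    (hv : v.asIdeal = Ideal.span ({(p : 𝓞 K)} : Set (𝓞 K))) :
    v.valuation K (p : K) = WithZero.exp (-1 : ℤ) := by
  have hp0 : (p : 𝓞 K) ≠ 0 := by exact_mod_cast hp.ne_zero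
  have h1 : v.intValuation (p : 𝓞 K) = WithZero.exp (-1 : ℤ) := v.intValuation_singleton hp0 hv
  have h2 : v.valuation K (algebraMap (𝓞 K) K (p : 𝓞 K)) = WithZero.exp (-1 : ℤ) := by
    rw [HeightOneSpectrum.valuation_of_algebraMap, h1]
  exact h2

/-- **Denominators prime to `p`**: at the principal prime `v = (p)`, every `s ∈ K` with
`v(s) ≤ 1` is `α/β` with `α, β ∈ 𝓞_K`, `β ∉ (p)` (cancel `p` from numerator and denominator;
induction on `|N(β)|`). [folklore] -/
theorem exists_mul_eq_of_valuation_le_one {p : ℕ} (hp : p.Prime) (v : HeightOneSpectrum (𝓞 K))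
    (hv : v.asIdeal = Ideal.span ({(p : 𝓞 K)} : Set (𝓞 K))) {s : K} (hs : v.valuation K s ≤ 1) :
    ∃ α β : 𝓞 K, β ∉ v.asIdeal ∧ s * algebraMap (𝓞 K) K β = algebraMap (𝓞 K) K α := by
  have hpK : (p : K) ≠ 0 := by exact_mod_cast hp.ne_zero
  set ι := Module.Free.ChooseBasisIndex ℤ (𝓞 K)
  haveI : Nonempty ι := (RingOfIntegers.basis K).index_nonempty
  have hN0 : Fintype.card ι ≠ 0 := Fintype.card_ne_zero
  have hnormp : Algebra.norm ℤ (p : 𝓞 K) = (p : ℤ) ^ Fintype.card ι := by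
    rw [← map_natCast (algebraMap ℤ (𝓞 K)) p]
    exact Algebra.norm_algebraMap_of_basis (RingOfIntegers.basis K) (p : ℤ)
  have hpn : 1 < p ^ Fintype.card ι := Nat.one_lt_pow hN0 hp.one_lt
  -- induction on the norm of the denominator
  suffices key : ∀ (N : ℕ) (α β : 𝓞 K), β ≠ 0 → (Algebra.norm ℤ β).natAbs ≤ N →
      v.valuation K (algebraMap (𝓞 K) K α / algebraMap (𝓞 K) K β) ≤ 1 →
        ∃ α' β' : 𝓞 K, β' ∉ v.asIdeal ∧
          algebraMap (𝓞 K) K α / algebraMap (𝓞 K) K β * algebraMap (𝓞 K) K β' =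
            algebraMap (𝓞 K) K α' by
    obtain ⟨α, β, hβ, rfl⟩ := IsFractionRing.div_surjective (A := 𝓞 K) s
    exact key _ α β (nonZeroDivisors.ne_zero hβ) le_rfl hs
  intro N
  induction N with
  | zero =>
    intro α β hβ hN _
    exact absurd (Int.natAbs_eq_zero.mp (Nat.le_zero.mp hN)) (Algebra.norm_ne_zero_iff.mpr hβ)
  | succ N ih =>
    intro α β hβ hN hval
    by_cases hβv : β ∈ v.asIdeal
    · -- `β = β₁ p`, and then `α = α₁ p`
      rw [hv] at hβv
      obtain ⟨β₁, hβ₁⟩ := Ideal.mem_span_singleton'.mp hβv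
      have hβ₁0 : β₁ ≠ 0 := by rintro rfl; rw [zero_mul] at hβ₁; exact hβ hβ₁.symm
      have hβK : algebraMap (𝓞 K) K β ≠ 0 :=
        (map_ne_zero_iff _ (IsFractionRing.injective (𝓞 K) K)).mpr hβ
      have hβlt : v.valuation K (algebraMap (𝓞 K) K β) < 1 := by
        rw [HeightOneSpectrum.valuation_of_algebraMap, v.intValuation_lt_one_iff_mem, hv]
        exact hβv
      have hαv : α ∈ Ideal.span ({(p : 𝓞 K)} : Set (𝓞 K)) := by
        rw [← hv, ← v.intValuation_lt_one_iff_mem, ← HeightOneSpectrum.valuation_of_algebraMap (K := K)]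
        have hαK : v.valuation K (algebraMap (𝓞 K) K α) =
            v.valuation K (algebraMap (𝓞 K) K α / algebraMap (𝓞 K) K β) *
              v.valuation K (algebraMap (𝓞 K) K β) := by
          rw [← Valuation.map_mul, div_mul_cancel₀ _ hβK]
        rw [hαK]
        calc _ ≤ 1 * v.valuation K (algebraMap (𝓞 K) K β) := mul_le_mul' hval le_rfl
          _ < 1 := by rw [one_mul]; exact hβlt
      obtain ⟨α₁, hα₁⟩ := Ideal.mem_span_singleton'.mp hαv
      -- norms: `|N β| = |N β₁| p^n > |N β₁|`
      have hnorm : (Algebra.norm ℤ β₁).natAbs < (Algebra.norm ℤ β).natAbs := by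
        have hNβ : Algebra.norm ℤ β = Algebra.norm ℤ β₁ * (p : ℤ) ^ Fintype.card ι := by
          rw [← hβ₁, map_mul, hnormp]
        rw [hNβ, Int.natAbs_mul, Int.natAbs_pow, Int.natAbs_natCast]
        exact lt_mul_of_one_lt_right (Int.natAbs_pos.mpr (Algebra.norm_ne_zero_iff.mpr hβ₁0)) hpn
      have heq : algebraMap (𝓞 K) K α / algebraMap (𝓞 K) K β =
          algebraMap (𝓞 K) K α₁ / algebraMap (𝓞 K) K β₁ := by
        rw [← hα₁, ← hβ₁, map_mul, map_mul, map_natCast]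
        exact mul_div_mul_right _ _ hpK
      obtain ⟨α', β', h1, h2⟩ := ih α₁ β₁ hβ₁0 (by omega) (heq ▸ hval)
      exact ⟨α', β', h1, heq ▸ h2⟩
    · exact ⟨α, β, hβv, div_mul_cancel₀ _
        ((map_ne_zero_iff _ (IsFractionRing.injective (𝓞 K) K)).mpr hβ)⟩

/-- **The residue ring `𝓞_K/(p)` has `p^{[K:ℚ]}` elements**: `#(𝓞_K/(p)) = |N(p)| = p^n` (for an
inert prime this is the residue field `𝔽_{p^n}`). [folklore] -/
theorem natCard_quotient_span_natCast (p : ℕ) :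
    Nat.card (𝓞 K ⧸ Ideal.span ({(p : 𝓞 K)} : Set (𝓞 K))) = p ^ Module.finrank ℚ K := by
  rw [← Submodule.cardQuot_apply, ← Ideal.absNorm_apply, Ideal.absNorm_span_singleton,
    ← map_natCast (algebraMap ℤ (𝓞 K)) p, Algebra.norm_algebraMap_of_basis (RingOfIntegers.basis K),
    Int.natAbs_pow, Int.natAbs_natCast, ← Module.finrank_eq_card_chooseBasisIndex,
    RingOfIntegers.rank]

/-- `1 + p + ⋯ + p^{n−1}` is odd for `p` odd and `n` odd. [folklore] -/
theorem odd_geom_sum {p n : ℕ} (hp : Odd p) (hn : Odd n) : Odd (∑ i ∈ Finset.range n, p ^ i) := by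
  rw [Nat.odd_iff, Finset.sum_nat_mod, Finset.sum_congr rfl fun i _ => Nat.odd_iff.mp (hp.pow (n := i)),
    Finset.sum_const, Finset.card_range, smul_eq_mul, mul_one]
  exact Nat.odd_iff.mp hn

/-- **An integer which is locally a square at an inert prime of odd residue degree is a quadratic
residue** (the step "`mᵢ ∉ K_{ℓᵢ}^{×2}` … (Recall that `n = [K : ℚ]` is odd.)" of the proof of
Prop. 5.4, p. 457): for a rational prime `p ≠ 2` remaining prime in the number field `K` of odd
degree, `v = (p)`, and an integer `N` prime to `p`, if `N = u r²` in `K` with `v(u − 1) < 1`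
then `(N/p) = 1`. Proof: write `r = α/β` with `β ∉ (p)`; then `N β² ≡ α² (mod (p))` in `𝓞_K`,
so `N^{(p^n − 1)/2} = 1` in the field `𝓞_K/(p)` of order `p^n`, hence `p ∣ N^{(p^n−1)/2} − 1`;
as `(p^n − 1)/2 = ((p − 1)/2)(1 + p + ⋯ + p^{n−1})` with odd second factor and
`N^{(p−1)/2} ≡ ±1`, Euler's criterion gives `N^{(p−1)/2} ≡ 1`. [cite: Matsuno2009, proof of Proposition 5.4] -/
theorem legendreSym_eq_one_of_isLocSq {p : ℕ} [Fact p.Prime] (hp2 : p ≠ 2)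
    (hodd : Odd (Module.finrank ℚ K)) (v : HeightOneSpectrum (𝓞 K))
    (hv : v.asIdeal = Ideal.span ({(p : 𝓞 K)} : Set (𝓞 K))) {N : ℤ} (hN : ¬ (p : ℤ) ∣ N)
    (h : (v.valuation K).IsLocSq (N : K)) : legendreSym p N = 1 := by
  have hp : p.Prime := Fact.out
  have hpodd : Odd p := hp.odd_of_ne_two hp2
  set n := Module.finrank ℚ K with hndef
  obtain ⟨u, s, hu, hs, hNus⟩ := h.out
  -- valuations: `v(N) = v(u) = 1`, hence `v(s) = 1`
  have hvN : v.valuation K (N : K) = 1 := valuation_intCast_eq_one v hv hN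
  have hvu : v.valuation K u = 1 := Valuation.map_eq_one_of_map_sub_one_lt hu
  have hvs : v.valuation K s = 1 := by
    have h2 : v.valuation K s ^ 2 = 1 := by
      have := hvN
      rwa [hNus, Valuation.map_mul, hvu, one_mul, Valuation.map_pow] at this
    have hlog := congrArg WithZero.log h2
    rw [WithZero.log_pow, WithZero.log_one, nsmul_eq_mul] at hlog
    have hs0 : v.valuation K s ≠ 0 := (v.valuation K).ne_zero_iff.mpr hs
    have hl : WithZero.log (v.valuation K s) = 0 := by
      rcases mul_eq_zero.mp hlog with h | h
      · exact absurd h (by norm_num)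
      · exact h
    rw [← WithZero.exp_log hs0, hl, WithZero.exp_zero]
  -- `s = α/β` with `β ∉ (p)`; then `N β² ≡ α² (mod (p))`
  obtain ⟨α, β, hβv, hsβ⟩ := exists_mul_eq_of_valuation_le_one hp v hv hvs.le
  have hβ1 : v.valuation K (algebraMap (𝓞 K) K β) = 1 := by
    have h1 : v.intValuation β = 1 := le_antisymm (v.intValuation_le_one β)
      (not_lt.mp fun h => hβv ((v.intValuation_lt_one_iff_mem β).mp h))
    rw [HeightOneSpectrum.valuation_of_algebraMap, h1]
  have hα1 : v.valuation K (algebraMap (𝓞 K) K α) = 1 := by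
    rw [← hsβ, Valuation.map_mul, hvs, hβ1, one_mul]
  have hmem : ((N : 𝓞 K) * β ^ 2 - α ^ 2 : 𝓞 K) ∈ v.asIdeal := by
    have heq : (algebraMap (𝓞 K) K) ((N : 𝓞 K) * β ^ 2 - α ^ 2) =
        (u - 1) * (algebraMap (𝓞 K) K α) ^ 2 := by
      rw [map_sub, map_mul, map_pow, map_pow, map_intCast, ← hsβ, hNus]
      ring
    have hlt : v.valuation K ((algebraMap (𝓞 K) K) ((N : 𝓞 K) * β ^ 2 - α ^ 2)) < 1 := by
      rw [heq, Valuation.map_mul, Valuation.map_pow, hα1, one_pow, mul_one]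
      exact hu
    rw [← v.intValuation_lt_one_iff_mem, ← HeightOneSpectrum.valuation_of_algebraMap (K := K)]
    exact hlt
  -- in the residue field `F = 𝓞_K/(p)`, of order `p^n`
  haveI hmax : v.asIdeal.IsMaximal := v.isMaximal
  letI : Field (𝓞 K ⧸ v.asIdeal) := Ideal.Quotient.field v.asIdeal
  haveI : Finite (𝓞 K ⧸ v.asIdeal) := Ideal.finiteQuotientOfFreeOfNeBot v.asIdeal v.ne_bot
  letI : Fintype (𝓞 K ⧸ v.asIdeal) := Fintype.ofFinite _
  have hcard : Fintype.card (𝓞 K ⧸ v.asIdeal) = p ^ n := by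
    rw [Fintype.card_eq_nat_card, hv]
    exact natCard_quotient_span_natCast p
  set π := Ideal.Quotient.mk v.asIdeal with hπ
  have hβF : π β ≠ 0 := fun h0 => hβv (Ideal.Quotient.eq_zero_iff_mem.mp h0)
  have hF : π (N : 𝓞 K) * π β ^ 2 = π α ^ 2 := by
    have h0 : π ((N : 𝓞 K) * β ^ 2 - α ^ 2) = 0 := Ideal.Quotient.eq_zero_iff_mem.mpr hmem
    rwa [map_sub, map_mul, map_pow, map_pow, sub_eq_zero] at h0
  have hNsq : π (N : 𝓞 K) = (π α * (π β)⁻¹) ^ 2 := by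
    rw [mul_pow, inv_pow, ← hF, mul_assoc, mul_inv_cancel₀ (pow_ne_zero 2 hβF), mul_one]
  have hαF : π α ≠ 0 := by
    intro h0
    rw [h0, zero_pow two_ne_zero, mul_eq_zero] at hF
    rcases hF with h | h
    · have hNv : (N : 𝓞 K) ∈ v.asIdeal := Ideal.Quotient.eq_zero_iff_mem.mp h
      rw [hv] at hNv
      exact hN (dvd_of_intCast_mem_span hNv)
    · exact hβF (pow_eq_zero_iff two_ne_zero |>.mp h)
  -- `N^{(p^n - 1)/2} = 1` in `F`
  have h2dvd : 2 ∣ p ^ n - 1 := by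
    have := (hpodd.pow (n := n))
    rcases this with ⟨c, hc⟩
    exact ⟨c, by omega⟩
  have hpowF : π (N : 𝓞 K) ^ ((p ^ n - 1) / 2) = 1 := by
    rw [hNsq, ← pow_mul, Nat.mul_div_cancel' h2dvd, ← hcard]
    exact FiniteField.pow_card_sub_one_eq_one _ (mul_ne_zero hαF (inv_ne_zero hβF))
  -- transport to `ℤ/p`
  set E := (p ^ n - 1) / 2 with hE
  have hdvd : (p : ℤ) ∣ N ^ E - 1 := by
    refine dvd_of_intCast_mem_span (K := K) ?_
    rw [← hv, ← Ideal.Quotient.eq_zero_iff_mem]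
    change π ((N ^ E - 1 : ℤ) : 𝓞 K) = 0
    rw [Int.cast_sub, Int.cast_pow, Int.cast_one, map_sub, map_pow, map_one, hpowF, sub_self]
  have hNp : ((N : ℤ) : ZMod p) ≠ 0 := by
    rwa [Ne, ZMod.intCast_zmod_eq_zero_iff_dvd]
  have hpowp : ((N : ℤ) : ZMod p) ^ E = 1 := by
    have h0 := (ZMod.intCast_zmod_eq_zero_iff_dvd (N ^ E - 1) p).mpr hdvd
    push_cast at h0
    exact sub_eq_zero.mp h0
  -- `E = (p / 2) · σ` with `σ = 1 + p + ⋯ + p^{n-1}` odd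
  set σ := ∑ i ∈ Finset.range n, p ^ i with hσ
  have hσodd : Odd σ := odd_geom_sum hpodd hodd
  have hgeom : p ^ n - 1 = (p - 1) * σ := by
    have h1 : 1 ≤ p ^ n := Nat.one_le_pow _ _ hp.pos
    have h2 : 1 ≤ p := hp.pos
    zify [h1, h2]
    rw [hσ]
    push_cast
    linear_combination (geom_sum_mul (p : ℤ) n).symm
  have hEeq : E = p / 2 * σ := by
    obtain ⟨q, hq⟩ := id hpodd
    have hp1 : p - 1 = 2 * q := by omega
    have hp2' : p / 2 = q := by omega
    rw [hE, hgeom, hp1, hp2', mul_assoc, Nat.mul_div_cancel_left _ two_pos]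
  -- Euler's criterion
  have heuler : ((N : ℤ) : ZMod p) ^ (p / 2) = 1 := by
    rcases ZMod.pow_div_two_eq_neg_one_or_one p hNp with h1 | h1
    · exact h1
    · exfalso
      rw [hEeq, pow_mul, h1, hσodd.neg_one_pow] at hpowp
      haveI : Fact (2 < p) := ⟨lt_of_le_of_ne hp.two_le (Ne.symm hp2)⟩
      exact ZMod.neg_one_ne_one hpowp
  exact (legendreSym.eq_one_iff p hNp).mpr ((ZMod.euler_criterion p hNp).mpr heuler)

/-- **`−1` is locally a square at `(ℓ)` for `ℓ ≡ 1 (mod 4)`** ((A1); the reason the node of `A`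
at `ℓᵢ` is split): `−1 ≡ i₀² (mod ℓ)` for an integer `i₀`, so `−1 = (−i₀²⁻¹·…)`, precisely
`−1 = (−i₀²)·(i₀⁻¹)²` with `−i₀² − 1 = −(i₀² + 1) ∈ (ℓ)`. [cite: Matsuno2009, §5 (A1)] -/
theorem isLocSq_neg_one_of_mod_four {ℓ : ℕ} (hℓ : ℓ.Prime) (h4 : ℓ % 4 = 1)
    (v : HeightOneSpectrum (𝓞 K)) (hv : v.asIdeal = Ideal.span ({(ℓ : 𝓞 K)} : Set (𝓞 K))) :
    (v.valuation K).IsLocSq (-1 : K) := by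
  haveI := Fact.mk hℓ
  obtain ⟨y, hy⟩ := (ZMod.exists_sq_eq_neg_one_iff (p := ℓ)).mpr (by omega)
  set i₀ : ℕ := y.val with hi₀
  have hyi : (i₀ : ZMod ℓ) = y := ZMod.natCast_zmod_val y
  have hdvd : ℓ ∣ i₀ ^ 2 + 1 := by
    rw [← ZMod.natCast_eq_zero_iff]
    push_cast
    rw [hyi, sq, ← hy, neg_add_cancel]
  have hndvd : ¬ ℓ ∣ i₀ := fun h => by
    have h1 : ℓ ∣ 1 := (Nat.dvd_add_right (Dvd.dvd.mul_left h i₀)).mp (by rwa [sq] at hdvd)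
    exact hℓ.one_lt.ne' (Nat.dvd_one.mp h1)
  have hi₀K : (i₀ : K) ≠ 0 := by
    have : i₀ ≠ 0 := fun h0 => hndvd (h0 ▸ dvd_zero ℓ)
    exact_mod_cast this
  refine ⟨⟨-((i₀ : K) ^ 2), ((i₀ : K))⁻¹, ?_, inv_ne_zero hi₀K, by field_simp⟩⟩
  -- `v(−i₀² − 1) = v(i₀² + 1) < 1`
  have hmem : ((i₀ ^ 2 + 1 : ℕ) : 𝓞 K) ∈ v.asIdeal := by
    rw [hv]
    obtain ⟨c, hc⟩ := hdvd
    refine Ideal.mem_span_singleton'.mpr ⟨(c : 𝓞 K), ?_⟩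
    rw [mul_comm]; exact_mod_cast hc.symm
  have hlt : v.valuation K (algebraMap (𝓞 K) K ((i₀ ^ 2 + 1 : ℕ) : 𝓞 K)) < 1 := by
    rw [HeightOneSpectrum.valuation_of_algebraMap, v.intValuation_lt_one_iff_mem]
    exact hmem
  rw [show -((i₀ : K) ^ 2) - 1 = -(((i₀ ^ 2 + 1 : ℕ) : K)) by push_cast; ring, Valuation.map_neg]
  exact hlt

end NumberField

/-! ## §4 Proposition 5.4 for the points of `A(K)` -/

namespace Literature.NumberTheory.EllipticCurves

namespace MatsunoParams

variable {K : Type*} [Field K] [NumberField K] {n k : ℕ} (P : MatsunoParams K n k)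

/-! ### The primes `(ℓᵢ)`, `(mⱼ)` of `K` and valuations there -/

/-- The prime `(ℓᵢ)` of `𝓞_K` ((A3): `ℓᵢ` remains prime) as a height-one prime. [cite: Matsuno2009, §5 (A3)] -/
theorem exists_heightOneSpectrum_ℓ (i : Fin k) :
    ∃ v : HeightOneSpectrum (𝓞 K), v.asIdeal = Ideal.span ({(P.ℓ i : 𝓞 K)} : Set (𝓞 K)) :=
  ⟨⟨_, P.isPrime_span_ℓ i, by
    rw [Ne, Ideal.span_singleton_eq_bot]; exact_mod_cast (P.prime_ℓ i).ne_zero⟩, rfl⟩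

/-- The prime `(mⱼ)` of `𝓞_K` ((A3)) as a height-one prime. [cite: Matsuno2009, §5 (A3)] -/
theorem exists_heightOneSpectrum_m (j : Fin k) :
    ∃ v : HeightOneSpectrum (𝓞 K), v.asIdeal = Ideal.span ({(P.m j : 𝓞 K)} : Set (𝓞 K)) :=
  ⟨⟨_, P.isPrime_span_m j, by
    rw [Ne, Ideal.span_singleton_eq_bot]; exact_mod_cast (P.prime_m j).ne_zero⟩, rfl⟩

/-- `ℓᵢ ∣ l` (`l = s ℓ₁⋯ℓ_k`). [cite: Matsuno2009, §5 (p. 456)] -/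
private theorem ℓ_dvd_bigL (i : Fin k) : P.ℓ i ∣ P.bigL :=
  (Finset.dvd_prod_of_mem P.ℓ (Finset.mem_univ i)).mul_left P.s

/-- `ℓᵢ ∤ m` (`l = 16m + 1`). [cite: Matsuno2009, §5 (p. 456)] -/
private theorem not_ℓ_dvd_bigM (i : Fin k) : ¬ P.ℓ i ∣ P.bigM := fun h => by
  have h1 : P.ℓ i ∣ 1 := by
    have h16 : P.ℓ i ∣ 16 * P.bigM := h.mul_left 16
    have hl := P.ℓ_dvd_bigL i
    rw [P.bigL_eq] at hl
    exact (Nat.dvd_add_right h16).mp hl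
  exact (P.prime_ℓ i).one_lt.ne' (Nat.dvd_one.mp h1)

/-- `mⱼ ∣ m` (`m = t m₁ⁿ⋯m_kⁿ`, and `n ≥ 1` as soon as there is an index `j`, by (A2)).
[cite: Matsuno2009, §5 (p. 456)] -/
private theorem m_dvd_bigM_of_index (j : Fin k) : P.m j ∣ P.bigM := by
  have hn : 0 < n := by
    rcases Nat.eq_zero_or_pos n with h | h
    · exact absurd (h ▸ dvd_zero (P.m j)) (P.not_m_dvd j)
    · exact h
  exact dvd_mul_of_dvd_right ((dvd_pow_self _ hn.ne').trans
    (Finset.dvd_prod_of_mem (fun i => P.m i ^ n) (Finset.mem_univ j))) _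

/-- `mⱼ ∤ l` (`l = 16m + 1`). [cite: Matsuno2009, §5 (p. 456)] -/
private theorem not_m_dvd_bigL' (j : Fin k) : ¬ P.m j ∣ P.bigL := fun h => by
  rw [P.bigL_eq] at h
  have h1 : P.m j ∣ 1 := (Nat.dvd_add_right ((P.m_dvd_bigM_of_index j).mul_left 16)).mp h
  exact (P.prime_m j).one_lt.ne' (Nat.dvd_one.mp h1)

/-- `ℓᵢ ≠ 2`, `mⱼ ≠ 2` are odd: an odd prime does not divide `2`. [folklore] -/
private theorem not_dvd_two_of_odd {q : ℕ} (hq : q.Prime) (hodd : Odd q) : ¬ (q : ℤ) ∣ 2 := by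
  intro h
  have h' : q ∣ 2 := by exact_mod_cast h
  have := (Nat.prime_dvd_prime_iff_eq hq Nat.prime_two).mp h'
  rw [this] at hodd
  exact (by decide : ¬ Odd 2) hodd

section AtL

variable {P} {i : Fin k} {v : HeightOneSpectrum (𝓞 K)}
  (hv : v.asIdeal = Ideal.span ({(P.ℓ i : 𝓞 K)} : Set (𝓞 K)))
include hv

/-- At `(ℓᵢ)`: `v(2) = 1`. [folklore] -/
theorem valuation_two_at_ℓ : v.valuation K (2 : K) = 1 := by
  have h := valuation_intCast_eq_one v hv (not_dvd_two_of_odd (P.prime_ℓ i) (P.odd_ℓ i))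
  exact_mod_cast h

/-- At `(ℓᵢ)`: `v(m) = 1` (`ℓᵢ ∤ m`). [folklore] -/
theorem valuation_bigM_at_ℓ : v.valuation K ((P.bigM : ℕ) : K) = 1 := by
  have h := valuation_intCast_eq_one v hv (z := (P.bigM : ℤ))
    (by exact_mod_cast P.not_ℓ_dvd_bigM i)
  exact_mod_cast h

/-- At `(ℓᵢ)`: `v(l) < 1` (`ℓᵢ ∣ l`). [folklore] -/
theorem valuation_bigL_at_ℓ : v.valuation K ((P.bigL : ℕ) : K) < 1 := by
  have hmem : ((P.bigL : ℕ) : 𝓞 K) ∈ v.asIdeal := by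
    rw [hv]
    obtain ⟨c, hc⟩ := P.ℓ_dvd_bigL i
    exact Ideal.mem_span_singleton'.mpr ⟨(c : 𝓞 K), by rw [mul_comm]; exact_mod_cast hc.symm⟩
  have h : v.valuation K (algebraMap (𝓞 K) K ((P.bigL : ℕ) : 𝓞 K)) < 1 := by
    rw [HeightOneSpectrum.valuation_of_algebraMap, v.intValuation_lt_one_iff_mem]
    exact hmem
  exact h

/-- At `(ℓᵢ)` the hypotheses of the local lemma hold for the labelling `(e₁, e₂, e₃) =
(−4m, −l/4, 0)`: `y = x − e₁` is the coordinate at the isolated abscissa (`e₂ ≡ 0 ≡ e₃`), and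
`e₂ − e₁ = −1/4` is locally a square since `ℓᵢ ≡ 1 (mod 4)` ((A1): the reduction is split).
[cite: Matsuno2009, proof of Proposition 5.4] -/
theorem localHyp_at_ℓ :
    v.valuation K P.e₁ ≤ 1 ∧ v.valuation K P.e₂ ≤ 1 ∧ v.valuation K (0 : K) ≤ 1 ∧
      v.valuation K (P.e₂ - 0) < 1 ∧ v.valuation K (P.e₁ - P.e₂) = 1 ∧
        (v.valuation K).IsLocSq (P.e₂ - P.e₁) := by
  have h2 := valuation_two_at_ℓ (K := K) hv
  have hm := valuation_bigM_at_ℓ (K := K) hv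
  have hl := valuation_bigL_at_ℓ (K := K) hv
  have h4 : v.valuation K (4 : K) = 1 := by
    rw [show (4 : K) = 2 * 2 by norm_num, Valuation.map_mul, h2, one_mul]
  have he₁ : v.valuation K P.e₁ = 1 := by
    rw [e₁, Valuation.map_neg, Valuation.map_mul, h4, hm, one_mul]
  have he₂ : v.valuation K P.e₂ < 1 := by
    have h := P.e₂_sub_zero
    rw [sub_zero] at h
    rw [h, map_div₀, Valuation.map_neg, h4, div_one]
    exact hl
  refine ⟨he₁.le, he₂.le, by rw [Valuation.map_zero]; exact zero_le, by rwa [sub_zero], ?_, ?_⟩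
  · rw [P.e₁_sub_e₂, map_div₀, Valuation.map_one, h4, div_one]
  · rw [P.e₂_sub_e₁, show (-(1 / 4) : K) = (-1) * (2⁻¹) ^ 2 by ring]
    exact (isLocSq_neg_one_of_mod_four (P.prime_ℓ i) (P.ℓ_mod_four i) v hv).mul
      (Valuation.IsLocSq.sq (inv_ne_zero two_ne_zero))

/-- **At `(ℓᵢ)` the first descent coordinate of every point of `A(K)` is locally a square**
("`y` is contained in the kernel of `K^×/K^{×2} → K_{ℓᵢ}^×/K_{ℓᵢ}^{×2}`", p. 457): there is a
representative `ρ` of `[x − e₁]` (`x − e₁`, or the torsion value, or `1` at `O`) with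
`IsLocSq v ρ`. [cite: Matsuno2009, proof of Proposition 5.4] -/
theorem exists_rep_fst_at_ℓ (Q : (P.curveA.baseChange K).toAffine.Point) :
    ∃ ρ : K, ρ ≠ 0 ∧ Point.twoDescentComponent (P.curveA.baseChange K).toAffine P.e₁ P.e₂ 0 Q = sqClass ρ ∧
      (v.valuation K).IsLocSq ρ := by
  haveI := P.isElliptic_curveA_baseChange
  have hsplit := P.splitTwoTorsion_baseChange
  obtain ⟨he₁, he₂, he₃, h₂₃, h₁₂, hsq⟩ := localHyp_at_ℓ (K := K) hv
  rcases Q with _ | ⟨x, y, hxy⟩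
  · exact ⟨1, one_ne_zero, (sqClass_one (F := K)).symm, Valuation.IsLocSq.one⟩
  · by_cases hx : x = P.e₁
    · refine ⟨(P.e₁ - P.e₂) * (P.e₁ - 0), hsplit.c_ne_zero, Point.twoDescentComponent_some_of_eq _ hx, ?_⟩
      exact Valuation.isLocSq_mul_sub_sub h₁₂ h₂₃
    · refine ⟨x - P.e₁, sub_ne_zero.mpr hx, Point.twoDescentComponent_some_of_ne _ hx, ?_⟩
      exact Valuation.isLocSq_sub_of_sq_eq he₁ he₂ he₃ h₂₃ h₁₂ hsq hx
        (Point.sq_eq_mul_mul_of_equation hsplit hxy.1)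

end AtL

section AtM

variable {P} {j : Fin k} {v : HeightOneSpectrum (𝓞 K)}
  (hv : v.asIdeal = Ideal.span ({(P.m j : 𝓞 K)} : Set (𝓞 K)))
include hv

/-- At `(mⱼ)`: `v(2) = 1`. [folklore] -/
theorem valuation_two_at_m : v.valuation K (2 : K) = 1 := by
  have h := valuation_intCast_eq_one v hv (not_dvd_two_of_odd (P.prime_m j) (P.odd_m j))
  exact_mod_cast h

/-- At `(mⱼ)`: `v(l) = 1` (`mⱼ ∤ l`). [folklore] -/
theorem valuation_bigL_at_m : v.valuation K ((P.bigL : ℕ) : K) = 1 := by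
  have h := valuation_intCast_eq_one v hv (z := (P.bigL : ℤ))
    (by exact_mod_cast P.not_m_dvd_bigL' j)
  exact_mod_cast h

/-- At `(mⱼ)`: `v(m) < 1` (`mⱼ ∣ m`). [folklore] -/
theorem valuation_bigM_at_m : v.valuation K ((P.bigM : ℕ) : K) < 1 := by
  have hmem : ((P.bigM : ℕ) : 𝓞 K) ∈ v.asIdeal := by
    rw [hv]
    obtain ⟨c, hc⟩ := P.m_dvd_bigM_of_index j
    exact Ideal.mem_span_singleton'.mpr ⟨(c : 𝓞 K), by rw [mul_comm]; exact_mod_cast hc.symm⟩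
  have h : v.valuation K (algebraMap (𝓞 K) K ((P.bigM : ℕ) : 𝓞 K)) < 1 := by
    rw [HeightOneSpectrum.valuation_of_algebraMap, v.intValuation_lt_one_iff_mem]
    exact hmem
  exact h

/-- At `(mⱼ)` the hypotheses of the local lemma hold for the labelling `(e₂, e₁, 0) =
(−l/4, −4m, 0)`: `z = x − e₂` is the coordinate at the isolated abscissa (`e₁ ≡ 0`), and
`e₁ − e₂ = 1/4` is a square. [cite: Matsuno2009, proof of Proposition 5.4] -/
theorem localHyp_at_m :
    v.valuation K P.e₂ ≤ 1 ∧ v.valuation K P.e₁ ≤ 1 ∧ v.valuation K (0 : K) ≤ 1 ∧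
      v.valuation K (P.e₁ - 0) < 1 ∧ v.valuation K (P.e₂ - P.e₁) = 1 ∧
        (v.valuation K).IsLocSq (P.e₁ - P.e₂) := by
  have h2 := valuation_two_at_m (K := K) hv
  have hm := valuation_bigM_at_m (K := K) hv
  have hl := valuation_bigL_at_m (K := K) hv
  have h4 : v.valuation K (4 : K) = 1 := by
    rw [show (4 : K) = 2 * 2 by norm_num, Valuation.map_mul, h2, one_mul]
  have he₁ : v.valuation K P.e₁ < 1 := by
    rw [e₁, Valuation.map_neg, Valuation.map_mul, h4, one_mul]
    exact hm
  have he₂ : v.valuation K P.e₂ = 1 := by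
    have h := P.e₂_sub_zero
    rw [sub_zero] at h
    rw [h, map_div₀, Valuation.map_neg, h4, div_one, hl]
  refine ⟨he₂.le, he₁.le, by rw [Valuation.map_zero]; exact zero_le, by rwa [sub_zero], ?_, ?_⟩
  · rw [P.e₂_sub_e₁, Valuation.map_neg, map_div₀, Valuation.map_one, h4, div_one]
  · rw [P.e₁_sub_e₂, show ((1 / 4) : K) = (2⁻¹) ^ 2 by ring]
    exact Valuation.IsLocSq.sq (inv_ne_zero two_ne_zero)

/-- **At `(mⱼ)` the second descent coordinate of every point of `A(K)` is locally a square**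
("the image of `z` in `K_{mⱼ}^×/K_{mⱼ}^{×2}` should be trivial for any `j`", p. 457).
[cite: Matsuno2009, proof of Proposition 5.4] -/
theorem exists_rep_snd_at_m (Q : (P.curveA.baseChange K).toAffine.Point) :
    ∃ ρ : K, ρ ≠ 0 ∧ Point.twoDescentComponent (P.curveA.baseChange K).toAffine P.e₂ P.e₁ 0 Q = sqClass ρ ∧
      (v.valuation K).IsLocSq ρ := by
  haveI := P.isElliptic_curveA_baseChange
  have hsplit := P.splitTwoTorsion_baseChange
  obtain ⟨he₂, he₁, he₃, h₁₃, h₂₁, hsq⟩ := localHyp_at_m (K := K) hv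
  rcases Q with _ | ⟨x, y, hxy⟩
  · exact ⟨1, one_ne_zero, (sqClass_one (F := K)).symm, Valuation.IsLocSq.one⟩
  · by_cases hx : x = P.e₂
    · refine ⟨(P.e₂ - P.e₁) * (P.e₂ - 0), hsplit.swap₁₂.c_ne_zero,
        Point.twoDescentComponent_some_of_eq _ hx, ?_⟩
      exact Valuation.isLocSq_mul_sub_sub h₂₁ h₁₃
    · refine ⟨x - P.e₂, sub_ne_zero.mpr hx, Point.twoDescentComponent_some_of_ne _ hx, ?_⟩
      have hY := Point.sq_eq_mul_mul_of_equation hsplit hxy.1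
      exact Valuation.isLocSq_sub_of_sq_eq he₂ he₁ he₃ h₁₃ h₂₁ hsq hx (hY.trans (by ring))

end AtM

/-! ### The span integers and their classes -/

/-- The integer `∏ ℓᵢ^{aᵢ} ∏ mⱼ^{bⱼ}` (`aᵢ, bⱼ ∈ {0,1}`) representing the class `spanClass (a, b)`
("suppose `y` is represented by `q := ℓ₁^{e₁}⋯ℓ_k^{e_k} m₁^{f₁}⋯m_k^{f_k}`", p. 457): its square
class is `spanClass`. [cite: Matsuno2009, proof of Proposition 5.4] -/
theorem sqClass_prod_eq_spanClass (c : SpanExpo k) :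
    sqClass ((((∏ i, P.ℓ i ^ (c.1 i).val) * ∏ j, P.m j ^ (c.2 j).val : ℕ) : ℤ) : K) =
      P.spanClass c := by
  push_cast
  rw [sqClass_mul (Finset.prod_ne_zero_iff.mpr fun i _ => pow_ne_zero _
        (by exact_mod_cast (P.prime_ℓ i).ne_zero))
      (Finset.prod_ne_zero_iff.mpr fun j _ => pow_ne_zero _ (by exact_mod_cast (P.prime_m j).ne_zero)),
    sqClass_finset_prod _ _ (fun i _ => pow_ne_zero _ (by exact_mod_cast (P.prime_ℓ i).ne_zero)),
    sqClass_finset_prod _ _ (fun j _ => pow_ne_zero _ (by exact_mod_cast (P.prime_m j).ne_zero))]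
  simp only [sqClass_pow]
  rfl

/-- If `[ρ] = [q]` in `K^×/K^{×2}` and `ρ` is locally a square at `v`, so is `q`. [folklore] -/
theorem isLocSq_of_sqClass_eq {v : HeightOneSpectrum (𝓞 K)} {ρ q : K} (hρ : ρ ≠ 0) (hq : q ≠ 0)
    (h : sqClass ρ = sqClass q) (hloc : (v.valuation K).IsLocSq ρ) : (v.valuation K).IsLocSq q := by
  have h1 : sqClass (ρ * q) = 1 := by rw [sqClass_mul hρ hq, h, SqUnits.mul_self]
  obtain ⟨z, hz⟩ := (sqClass_eq_one_iff (mul_ne_zero hρ hq)).mp h1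
  have hz0 : z ≠ 0 := by rintro rfl; rw [zero_pow two_ne_zero] at hz; exact mul_ne_zero hρ hq hz
  exact hloc.of_mul_eq_sq hz0 hz

/-- `ord_v` of a finite product of non-zero valuations is the sum. [folklore] -/
private theorem log_prod {ι : Type*} (s : Finset ι) (f : ι → ℤᵐ⁰) (hf : ∀ i ∈ s, f i ≠ 0) :
    WithZero.log (∏ i ∈ s, f i) = ∑ i ∈ s, WithZero.log (f i) := by
  induction s using Finset.cons_induction with
  | empty => simp
  | cons a s ha ih =>
    rw [Finset.prod_cons, Finset.sum_cons,
      WithZero.log_mul (hf a (Finset.mem_cons_self a s))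
        (Finset.prod_ne_zero_iff.mpr fun i hi => hf i (Finset.mem_cons_of_mem hi)),
      ih fun i hi => hf i (Finset.mem_cons_of_mem hi)]

/-- **`ord_{ℓᵢ}` of the span integer**: `ord_{ℓᵢ}(∏ ℓ^{a} ∏ m^{b}) = aᵢ` (the `ℓ`'s, `m`'s are
distinct primes remaining prime in `K`); in Mathlib's normalisation `log v = −aᵢ`.
[cite: Matsuno2009, proof of Proposition 5.4] -/
theorem log_valuation_prod_at_ℓ {i : Fin k} {v : HeightOneSpectrum (𝓞 K)}
    (hv : v.asIdeal = Ideal.span ({(P.ℓ i : 𝓞 K)} : Set (𝓞 K))) (a b : Fin k → ZMod 2) :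
    WithZero.log (v.valuation K
      ((((∏ i', P.ℓ i' ^ (a i').val) * ∏ j, P.m j ^ (b j).val : ℕ) : ℤ) : K)) = -((a i).val : ℤ) := by
  have hℓ : ∀ i', v.valuation K ((P.ℓ i' : ℕ) : K) = if i' = i then WithZero.exp (-1 : ℤ) else 1 := by
    intro i'
    split_ifs with h
    · subst h; exact valuation_natCast_self (P.prime_ℓ i') v hv
    · have h' := valuation_intCast_eq_one v hv (z := (P.ℓ i' : ℤ)) (by
        intro hd
        have hd' : P.ℓ i ∣ P.ℓ i' := by exact_mod_cast hd
        exact h (P.injective_ℓ ((Nat.prime_dvd_prime_iff_eq (P.prime_ℓ i) (P.prime_ℓ i')).mp hd')).symm)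
      exact_mod_cast h'
  have hm : ∀ j, v.valuation K ((P.m j : ℕ) : K) = 1 := by
    intro j
    have h' := valuation_intCast_eq_one v hv (z := (P.m j : ℤ)) (by
      intro hd
      have hd' : P.ℓ i ∣ P.m j := by exact_mod_cast hd
      exact P.ℓ_ne_m i j ((Nat.prime_dvd_prime_iff_eq (P.prime_ℓ i) (P.prime_m j)).mp hd'))
    exact_mod_cast h'
  push_cast
  rw [Valuation.map_mul, map_prod, map_prod]
  simp only [Valuation.map_pow, hℓ, hm, one_pow, Finset.prod_const_one, mul_one]
  rw [log_prod _ _ (fun i' _ => by split_ifs <;> simp), Finset.sum_eq_single i]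
  · rw [if_pos rfl, WithZero.log_pow, WithZero.log_exp, nsmul_eq_mul, mul_neg, mul_one]
  · intro i' _ hi'
    rw [if_neg hi', one_pow, WithZero.log_one]
  · intro h; exact absurd (Finset.mem_univ i) h

/-- **`ord_{mⱼ}` of the span integer**: `log v = −bⱼ` at `v = (mⱼ)`. [cite: Matsuno2009, proof of Proposition 5.4] -/
theorem log_valuation_prod_at_m {j : Fin k} {v : HeightOneSpectrum (𝓞 K)}
    (hv : v.asIdeal = Ideal.span ({(P.m j : 𝓞 K)} : Set (𝓞 K))) (a b : Fin k → ZMod 2) :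
    WithZero.log (v.valuation K
      ((((∏ i, P.ℓ i ^ (a i).val) * ∏ j', P.m j' ^ (b j').val : ℕ) : ℤ) : K)) = -((b j).val : ℤ) := by
  have hm : ∀ j', v.valuation K ((P.m j' : ℕ) : K) = if j' = j then WithZero.exp (-1 : ℤ) else 1 := by
    intro j'
    split_ifs with h
    · subst h; exact valuation_natCast_self (P.prime_m j') v hv
    · have h' := valuation_intCast_eq_one v hv (z := (P.m j' : ℤ)) (by
        intro hd
        have hd' : P.m j ∣ P.m j' := by exact_mod_cast hd
        exact h (P.injective_m ((Nat.prime_dvd_prime_iff_eq (P.prime_m j) (P.prime_m j')).mp hd')).symm)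
      exact_mod_cast h'
  have hℓ : ∀ i, v.valuation K ((P.ℓ i : ℕ) : K) = 1 := by
    intro i
    have h' := valuation_intCast_eq_one v hv (z := (P.ℓ i : ℤ)) (by
      intro hd
      have hd' : P.m j ∣ P.ℓ i := by exact_mod_cast hd
      exact P.ℓ_ne_m i j ((Nat.prime_dvd_prime_iff_eq (P.prime_m j) (P.prime_ℓ i)).mp hd').symm)
    exact_mod_cast h'
  push_cast
  rw [Valuation.map_mul, map_prod, map_prod]
  simp only [Valuation.map_pow, hℓ, hm, one_pow, Finset.prod_const_one, one_mul]
  rw [log_prod _ _ (fun j' _ => by split_ifs <;> simp), Finset.sum_eq_single j]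
  · rw [if_pos rfl, WithZero.log_pow, WithZero.log_exp, nsmul_eq_mul, mul_neg, mul_one]
  · intro j' _ hj'
    rw [if_neg hj', one_pow, WithZero.log_one]
  · intro h; exact absurd (Finset.mem_univ j) h

/-- An element of `ℤ/2` with even representative in `{0, 1}` is `0`. [folklore] -/
private theorem zmod_two_eq_zero_of_dvd_val {x : ZMod 2} (h : (2 : ℤ) ∣ (x.val : ℤ)) : x = 0 := by
  have hlt : x.val < 2 := x.val_lt
  have h' : 2 ∣ x.val := by exact_mod_cast h
  have h0 : x.val = 0 := by omega
  exact (ZMod.val_eq_zero x).mp h0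

/-- `(−1)^b = 1` in `ℤ` forces `b = 0` for `b ∈ ℤ/2`. [folklore] -/
private theorem zmod_two_eq_zero_of_neg_one_pow {x : ZMod 2} (h : (-1 : ℤ) ^ x.val = 1) : x = 0 := by
  rcases Nat.even_or_odd x.val with he | ho
  · obtain ⟨c, hc⟩ := he
    have hlt : x.val < 2 := x.val_lt
    have h0 : x.val = 0 := by omega
    exact (ZMod.val_eq_zero x).mp h0
  · rw [ho.neg_one_pow] at h
    norm_num at h

/-- **Quadratic reciprocity for the parameters**: `(ℓᵢ/mⱼ) = (mⱼ/ℓᵢ) = (−1)^{δᵢⱼ}` since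
`ℓᵢ ≡ 1 (mod 4)` ((A1), (A4); the step "`(ℓᵢ/mⱼ) = (−1)^{δᵢⱼ}` by (A1) and (A4)" of the
proof of Prop. 5.4). [cite: Matsuno2009, proof of Proposition 5.4] -/
theorem jacobiSym_ℓ_m_eq (i j : Fin k) : jacobiSym (P.ℓ i) (P.m j) = if i = j then -1 else 1 := by
  rw [← P.jacobiSym_m_ℓ i j]
  exact jacobiSym.quadratic_reciprocity_one_mod_four (P.ℓ_mod_four i) (P.odd_m j)

/-- **Matsuno 2009, Proposition 5.4** with "`dim_{𝔽₂} L = 4k`" (p. 457), for the points of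
`A(K)` — the hypothesis `h54` of `MatsunoParams.mordellWeilRank_le_of_lemma53_of_prop54`: for
Matsuno's parameters over a number field `K` of odd degree, if `spanMap ((a,b),(a',b')) ∈ λ_K(A(K))`
then `a = b = a' = b' = 0`. Proof as printed: the first coordinate `y ≡ ∏ ℓᵢ^{aᵢ} mⱼ^{bⱼ}` is
locally a square at each `(ℓᵢ)` (`exists_rep_fst_at_ℓ`), so `ord_{ℓᵢ}` is even — `aᵢ = 0` —
and then `∏ⱼ (mⱼ/ℓᵢ)^{bⱼ} = (−1)^{bᵢ} = 1` by (A4) (`legendreSym_eq_one_of_isLocSq`, `n` odd) —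
`bᵢ = 0`; the second coordinate `z ≡ ∏ ℓᵢ^{a'ᵢ} mⱼ^{b'ⱼ}` is locally a square at each `(mⱼ)`,
so `b'ⱼ = 0` and `∏ᵢ (ℓᵢ/mⱼ)^{a'ᵢ} = (−1)^{a'ⱼ} = 1` by (A1), (A4) and reciprocity — `a'ⱼ = 0`.
[cite: Matsuno2009, Proposition 5.4 (with "dim L = 4k", p. 457)] -/
theorem eq_zero_of_spanMap_mem_descentRange (hK : Module.finrank ℚ K = n) (hn : Odd n)
    (c : SpanExpo k × SpanExpo k) (hc : P.spanMap c ∈ P.descentRange) : c = 0 := by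
  have hodd : Odd (Module.finrank ℚ K) := hK ▸ hn
  obtain ⟨Q, hQ⟩ := hc
  rw [descentMap_apply, spanMap_apply] at hQ
  have hQ' := Additive.ofMul.injective hQ
  rw [Prod.mk.injEq] at hQ'
  obtain ⟨h1, h2⟩ := hQ'
  obtain ⟨⟨a, b⟩, ⟨a', b'⟩⟩ := c
  -- the span integers
  set q₁ : ℕ := (∏ i, P.ℓ i ^ (a i).val) * ∏ j, P.m j ^ (b j).val with hq₁
  set q₂ : ℕ := (∏ i, P.ℓ i ^ (a' i).val) * ∏ j, P.m j ^ (b' j).val with hq₂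
  have hq₁0 : ((q₁ : ℤ) : K) ≠ 0 := by
    have : q₁ ≠ 0 := Nat.mul_ne_zero
      (Finset.prod_ne_zero_iff.mpr fun i _ => pow_ne_zero _ (P.prime_ℓ i).ne_zero)
      (Finset.prod_ne_zero_iff.mpr fun j _ => pow_ne_zero _ (P.prime_m j).ne_zero)
    exact_mod_cast this
  have hq₂0 : ((q₂ : ℤ) : K) ≠ 0 := by
    have : q₂ ≠ 0 := Nat.mul_ne_zero
      (Finset.prod_ne_zero_iff.mpr fun i _ => pow_ne_zero _ (P.prime_ℓ i).ne_zero)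
      (Finset.prod_ne_zero_iff.mpr fun j _ => pow_ne_zero _ (P.prime_m j).ne_zero)
    exact_mod_cast this
  have hc₁ : sqClass (((q₁ : ℤ)) : K) = P.spanClass (a, b) := P.sqClass_prod_eq_spanClass (a, b)
  have hc₂ : sqClass (((q₂ : ℤ)) : K) = P.spanClass (a', b') := P.sqClass_prod_eq_spanClass (a', b')
  -- first coordinate: locally a square at every `(ℓᵢ)`
  have hloc₁ : ∀ i : Fin k, ∀ v : HeightOneSpectrum (𝓞 K),
      v.asIdeal = Ideal.span ({(P.ℓ i : 𝓞 K)} : Set (𝓞 K)) →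
        (v.valuation K).IsLocSq (((q₁ : ℤ)) : K) := by
    intro i v hv
    obtain ⟨ρ, hρ0, hρ, hloc⟩ := exists_rep_fst_at_ℓ (K := K) hv Q
    refine isLocSq_of_sqClass_eq hρ0 hq₁0 ?_ hloc
    rw [← hρ, hc₁]
    exact h1
  -- second coordinate: locally a square at every `(mⱼ)`
  have hloc₂ : ∀ j : Fin k, ∀ v : HeightOneSpectrum (𝓞 K),
      v.asIdeal = Ideal.span ({(P.m j : 𝓞 K)} : Set (𝓞 K)) →
        (v.valuation K).IsLocSq (((q₂ : ℤ)) : K) := by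
    intro j v hv
    obtain ⟨ρ, hρ0, hρ, hloc⟩ := exists_rep_snd_at_m (K := K) hv Q
    refine isLocSq_of_sqClass_eq hρ0 hq₂0 ?_ hloc
    rw [← hρ, hc₂]
    exact h2
  -- parity: `a = 0`, `b' = 0`
  have ha : a = 0 := by
    funext i
    obtain ⟨v, hv⟩ := P.exists_heightOneSpectrum_ℓ i
    have hpar := (hloc₁ i v hv).two_dvd_log
    rw [hq₁, P.log_valuation_prod_at_ℓ hv a b, dvd_neg] at hpar
    exact zmod_two_eq_zero_of_dvd_val hpar
  have hb' : b' = 0 := by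
    funext j
    obtain ⟨v, hv⟩ := P.exists_heightOneSpectrum_m j
    have hpar := (hloc₂ j v hv).two_dvd_log
    rw [hq₂, P.log_valuation_prod_at_m hv a' b', dvd_neg] at hpar
    exact zmod_two_eq_zero_of_dvd_val hpar
  subst ha
  subst hb'
  -- quadratic residues: `b = 0`, `a' = 0`
  have hq₁' : (q₁ : ℤ) = ∏ j, (P.m j : ℤ) ^ (b j).val := by
    rw [hq₁]; push_cast; simp
  have hq₂' : (q₂ : ℤ) = ∏ i, (P.ℓ i : ℤ) ^ (a' i).val := by
    rw [hq₂]; push_cast; simp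
  have hb : b = 0 := by
    funext i
    obtain ⟨v, hv⟩ := P.exists_heightOneSpectrum_ℓ i
    haveI := Fact.mk (P.prime_ℓ i)
    have hℓ2 : P.ℓ i ≠ 2 := fun h => by have := P.ℓ_mod_four i; omega
    have hcop : ¬ ((P.ℓ i : ℕ) : ℤ) ∣ (q₁ : ℤ) := by
      rw [hq₁']
      intro hd
      obtain ⟨j, -, hj⟩ := (Prime.dvd_finsetProd_iff (Nat.prime_iff_prime_int.mp (P.prime_ℓ i)) _).mp hd
      have hj' : (P.ℓ i : ℤ) ∣ (P.m j : ℤ) := Int.Prime.dvd_pow' (P.prime_ℓ i) hj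
      have : P.ℓ i ∣ P.m j := by exact_mod_cast hj'
      exact P.ℓ_ne_m i j ((Nat.prime_dvd_prime_iff_eq (P.prime_ℓ i) (P.prime_m j)).mp this)
    have hleg := legendreSym_eq_one_of_isLocSq hℓ2 hodd v hv hcop (hloc₁ i v hv)
    rw [jacobiSym.legendreSym.to_jacobiSym, hq₁', ← KramerParams.jacobiSymHom_apply, map_prod] at hleg
    simp only [map_pow, KramerParams.jacobiSymHom_apply, P.jacobiSym_m_ℓ] at hleg
    rw [Finset.prod_eq_single i (fun j _ hj => by rw [if_neg (Ne.symm hj), one_pow])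
      (fun h => absurd (Finset.mem_univ i) h), if_pos rfl] at hleg
    exact zmod_two_eq_zero_of_neg_one_pow hleg
  have ha' : a' = 0 := by
    funext j
    obtain ⟨v, hv⟩ := P.exists_heightOneSpectrum_m j
    haveI := Fact.mk (P.prime_m j)
    have hm2 : P.m j ≠ 2 := fun h => by
      have := P.odd_m j; rw [h] at this; exact (by decide : ¬ Odd 2) this
    have hcop : ¬ ((P.m j : ℕ) : ℤ) ∣ (q₂ : ℤ) := by
      rw [hq₂']
      intro hd
      obtain ⟨i, -, hi⟩ := (Prime.dvd_finsetProd_iff (Nat.prime_iff_prime_int.mp (P.prime_m j)) _).mp hd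
      have hi' : (P.m j : ℤ) ∣ (P.ℓ i : ℤ) := Int.Prime.dvd_pow' (P.prime_m j) hi
      have : P.m j ∣ P.ℓ i := by exact_mod_cast hi'
      exact P.ℓ_ne_m i j ((Nat.prime_dvd_prime_iff_eq (P.prime_m j) (P.prime_ℓ i)).mp this).symm
    have hleg := legendreSym_eq_one_of_isLocSq hm2 hodd v hv hcop (hloc₂ j v hv)
    rw [jacobiSym.legendreSym.to_jacobiSym, hq₂', ← KramerParams.jacobiSymHom_apply, map_prod] at hleg
    simp only [map_pow, KramerParams.jacobiSymHom_apply, P.jacobiSym_ℓ_m_eq] at hleg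
    rw [Finset.prod_eq_single j (fun i _ hi => by rw [if_neg hi, one_pow])
      (fun h => absurd (Finset.mem_univ j) h), if_pos rfl] at hleg
    exact zmod_two_eq_zero_of_neg_one_pow hleg
  subst hb
  subst ha'
  rfl

end MatsunoParams

end Literature.NumberTheory.EllipticCurves

end
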